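import Literature.Analysis.FluidPDE.TorusHeatHolder
import Literature.Analysis.UnboundedOperators.HeatKernelCommutator
import HarnessLib

/-!
# Heat-kernel proof of the Hölder commutator estimate for third derivatives of the inverse
# Laplacian on the torus

Analysis/FluidPDE support file (all results proved; no definitions, no named facts). It serves
the discharge of the named fact `Literature.Analysis.FluidPDE.BDSV.commutatorCZBound`
(`FluidPDE/OnsagerBDSVPotentialTheory`; Buckmaster–De Lellis–Székelyhidi–Vicol 2019, App. D,
Prop. D.1, after Constantin 2015, Lemma 1: `‖[∂ᵢ∂ⱼΔ⁻¹, b·∇]f‖_α ≲ ‖b‖_{1+α}‖f‖_α`), and continues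
`FluidPDE/TorusHeatHolder` (heat-kernel proof of App. C, Prop. C.1) and
`UnboundedOperators/HeatKernelCommutator` (kernel-level commutator bounds
`‖[∂ᵢ∂ⱼ∂ₗe^{σΔ}, m]F‖_∞ ≲ σ^{β/2-1}`, `‖[∂ᵤ∂ᵢ∂ⱼ∂ₗe^{σΔ}, m]F‖_∞ ≲ σ^{(β-3)/2}`).

Writing `b·∇f = ∑ₖ ∂ₖ(bₖf) - (div b) f` reduces `[∂ᵢ∂ⱼΔ⁻¹, b·∇]f` to the commutators
`[∂ᵢ∂ⱼ∂ₖΔ⁻¹, bₖ] f` of the *first-order* operators `T₃ = ∂ᵢ∂ⱼ∂ₖΔ⁻¹` with a multiplication (plus a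
term handled by Prop. C.1). This file proves the `C^{0,β}` estimate for such commutators through
the heat semigroup, in the abstract form of `TorusHeat.exists_holder_bound_lineDeriv₂`: if `p, q`
are smooth on `T^d` with `Δ(∂₁∂₂∂₃p) = ∂₁∂₂∂₃(mG)` and `Δ(∂₁∂₂∂₃q) = ∂₁∂₂∂₃G` (for `T₃`:
`p = Δ⁻¹(mG)`, `q = Δ⁻¹G`), then by the representation
`(∂³p)~ = e^{Δ}(∂³p)~ - ∫₀¹ e^{σΔ}(∂³(mG))~ dσ` (`lift_eq_heatExtension_one_sub_integral`) the
commutator `Q = (∂³p)~ - m̃ (∂³q)~` splits into the far field `e^{Δ}(∂³p)~ - m̃ e^{Δ}(∂³q)~`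
(bounded with its gradient by `sup|p|`, `sup|q|`, `‖m‖_{C¹}`) and the near field
`-∫₀¹ {∂³e^{σΔ}(m̃G̃) - m̃ ∂³e^{σΔ}G̃} dσ`, whose integrand has size `≲ σ^{β/2-1}` and Lipschitz
constant `≲ σ^{(β-3)/2}` by the kernel bounds, so that the abstract near-field calculus
`norm_integral_Ioc_sub_le_of_bounds` applies.

## Main results

* `heatExtension_lift_lineDeriv_succ_eq_fderiv`, `heatExtension_lift_lineDeriv₃_eq`,
  `heatExtension_lift_lineDeriv₄_eq`: the heat flow of lifted derivatives as iterated derivatives of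
  heat flows (`e^{3aΔ}(∂₁∂₂∂₃ψ)~ = ∂₁e^{aΔ}∂₂e^{aΔ}∂₃e^{aΔ}ψ̃`);
* `norm_heatExtension_lift_lineDeriv₄_le_of_bound`, `norm_heatExtension_one_lift_lineDeriv₃_le`,
  `norm_heatExtension_one_lift_lineDeriv₃_sub_le`: fourth-order smoothing and the far field;
* `exists_holder_bound_commutator₃`: **the commutator estimate** — a constant `K = K(d, β)` with
  `|Q| ≤ K S ‖v₁‖‖v₂‖‖v₃‖` and `|Q x - Q y| ≤ K S ‖v₁‖‖v₂‖‖v₃‖ |x - y|^β`,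
  `S = sup|p| + (sup|m| + ‖∇m̃‖_∞) sup|q| + ‖∇m̃‖_∞ [G̃]_β + [∇m̃]_β sup|G|`.

## References

* T. Buckmaster, C. De Lellis, L. Székelyhidi Jr., V. Vicol, *Onsager's conjecture for admissible
  weak solutions*, CPAM 72 (2019) = arXiv:1701.08678, App. D, Prop. D.1 (consumer).
  [`BuckmasterEtAl2018`]
* P. Constantin, *Lagrangian–Eulerian methods for uniqueness in hydrodynamic systems*, Adv. Math.
  278 (2015) 67–102, Lemma 1.
* A. Lunardi, *Analytic Semigroups and Optimal Regularity in Parabolic Problems* (1995), §3.1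
  (Hölder estimates via the heat semigroup; the model for the splitting argument).
-/

noncomputable section

open MeasureTheory Set Filter Topology InnerProductSpace
open Literature.Analysis.UnboundedOperators
open scoped Real ENNReal NNReal Laplacian ContDiff

namespace Literature.Analysis.FluidPDE

namespace TorusHeat

/-! ## Heat flows of lifted derivatives as derivatives of heat flows -/

section Bridge

variable {d : Type*} [Fintype d]
variable {F : Type*} [NormedAddCommGroup F] [NormedSpace ℝ F] [CompleteSpace F]

/-- One step: `e^{(s+a)Δ}(∂ᵥψ)~(x) = ∂ᵥ(e^{aΔ}(e^{sΔ}ψ̃))(x)` for a smooth torus function `ψ`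
(derivatives fall on the data, semigroup law). [folklore] -/
theorem heatExtension_lift_lineDeriv_succ_eq_fderiv {ψ : UnitAddTorus d → F}
    (hψ : FunctionSpaces.Torus.IsSmooth ψ) {s a : ℝ} (hs : 0 < s) (ha : 0 < a)
    (x v : EuclideanSpace ℝ d) :
    heatExtension (FunctionSpaces.Torus.lift (fun z => FunctionSpaces.Torus.lineDeriv ψ z v)) (s + a) x =
      fderiv ℝ (heatExtension (heatExtension (FunctionSpaces.Torus.lift ψ) s) a) x v := by
  rw [← fderiv_heatExtension_lift_apply hψ (by linarith) x v,
    ← heatExtension_heatExtension_lift hψ.continuous hs ha]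

/-- Base step: `e^{aΔ}(∂ᵥψ)~ = ∂ᵥ e^{aΔ}ψ̃` as functions. [folklore] -/
theorem heatExtension_lift_lineDeriv_eq_fderiv {ψ : UnitAddTorus d → F}
    (hψ : FunctionSpaces.Torus.IsSmooth ψ) {a : ℝ} (ha : 0 < a) (v : EuclideanSpace ℝ d) :
    heatExtension (FunctionSpaces.Torus.lift (fun z => FunctionSpaces.Torus.lineDeriv ψ z v)) a =
      fun y => fderiv ℝ (heatExtension (FunctionSpaces.Torus.lift ψ) a) y v :=
  funext fun y => (fderiv_heatExtension_lift_apply hψ ha y v).symm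

/-- **Three derivatives**: `e^{3aΔ}(∂₁∂₂∂₃ψ)~(x) = ∂₁e^{aΔ}(∂₂e^{aΔ}(∂₃e^{aΔ}ψ̃))(x)`. [folklore] -/
theorem heatExtension_lift_lineDeriv₃_eq {ψ : UnitAddTorus d → F}
    (hψ : FunctionSpaces.Torus.IsSmooth ψ) {a : ℝ} (ha : 0 < a) (x v₁ v₂ v₃ : EuclideanSpace ℝ d) :
    heatExtension (FunctionSpaces.Torus.lift (fun z => FunctionSpaces.Torus.lineDeriv
        (fun z' => FunctionSpaces.Torus.lineDeriv (fun z'' => FunctionSpaces.Torus.lineDeriv ψ z'' v₃) z' v₂) z v₁))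
        (a + a + a) x =
      fderiv ℝ (heatExtension (fun y' => fderiv ℝ (heatExtension
        (fun y => fderiv ℝ (heatExtension (FunctionSpaces.Torus.lift ψ) a) y v₃) a) y' v₂) a) x v₁ := by
  have h3 := hψ.lineDeriv v₃
  have h23 := h3.lineDeriv v₂
  have haa : 0 < a + a := by linarith
  rw [heatExtension_lift_lineDeriv_succ_eq_fderiv h23 haa ha x v₁]
  have e2 : heatExtension (FunctionSpaces.Torus.lift (fun z' => FunctionSpaces.Torus.lineDeriv
      (fun z'' => FunctionSpaces.Torus.lineDeriv ψ z'' v₃) z' v₂)) (a + a) =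
      fun y' => fderiv ℝ (heatExtension (heatExtension (FunctionSpaces.Torus.lift
        (fun z'' => FunctionSpaces.Torus.lineDeriv ψ z'' v₃)) a) a) y' v₂ :=
    funext fun y' => heatExtension_lift_lineDeriv_succ_eq_fderiv h3 ha ha y' v₂
  rw [e2, heatExtension_lift_lineDeriv_eq_fderiv hψ ha v₃]

/-- **Four derivatives**: `e^{4aΔ}(∂₀∂₁∂₂∂₃ψ)~(x) = ∂₀e^{aΔ}(∂₁e^{aΔ}(∂₂e^{aΔ}(∂₃e^{aΔ}ψ̃)))(x)`.
[folklore] -/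
theorem heatExtension_lift_lineDeriv₄_eq {ψ : UnitAddTorus d → F}
    (hψ : FunctionSpaces.Torus.IsSmooth ψ) {a : ℝ} (ha : 0 < a) (x v₀ v₁ v₂ v₃ : EuclideanSpace ℝ d) :
    heatExtension (FunctionSpaces.Torus.lift (fun z₀ => FunctionSpaces.Torus.lineDeriv
        (fun z => FunctionSpaces.Torus.lineDeriv (fun z' => FunctionSpaces.Torus.lineDeriv
          (fun z'' => FunctionSpaces.Torus.lineDeriv ψ z'' v₃) z' v₂) z v₁) z₀ v₀))
        (a + a + a + a) x =
      fderiv ℝ (heatExtension (fun y'' => fderiv ℝ (heatExtension (fun y' => fderiv ℝ (heatExtension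
        (fun y => fderiv ℝ (heatExtension (FunctionSpaces.Torus.lift ψ) a) y v₃) a) y' v₂) a) y'' v₁) a) x v₀ := by
  have h3 := hψ.lineDeriv v₃
  have h23 := h3.lineDeriv v₂
  have h123 := h23.lineDeriv v₁
  have haaa : 0 < a + a + a := by linarith
  rw [heatExtension_lift_lineDeriv_succ_eq_fderiv h123 haaa ha x v₀]
  have e3 : heatExtension (FunctionSpaces.Torus.lift (fun z => FunctionSpaces.Torus.lineDeriv
      (fun z' => FunctionSpaces.Torus.lineDeriv (fun z'' => FunctionSpaces.Torus.lineDeriv ψ z'' v₃) z' v₂) z v₁))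
      (a + a + a) =
      fun y'' => fderiv ℝ (heatExtension (fun y' => fderiv ℝ (heatExtension
        (fun y => fderiv ℝ (heatExtension (FunctionSpaces.Torus.lift ψ) a) y v₃) a) y' v₂) a) y'' v₁ :=
    funext fun y'' => heatExtension_lift_lineDeriv₃_eq hψ ha y'' v₁ v₂ v₃
  rw [e3]

end Bridge

/-! ## Fourth-order smoothing; the far field for third derivatives -/

section Smoothing

variable {d : Type*} [Fintype d]
variable {F : Type*} [NormedAddCommGroup F] [NormedSpace ℝ F] [CompleteSpace F]

/-- **Fourth-order smoothing bound, bounded data**: for a smooth torus function `g` with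
`‖g‖ ≤ B`, `‖e^{4aΔ} (∂₀∂₁∂₂∂₃ g)~ (x)‖ ≤ (2^{n/2} a^{-1/2})⁴ B ‖v₀‖ ‖v₁‖ ‖v₂‖ ‖v₃‖` (one more
smoothing step on `norm_heatExtension_lift_lineDeriv₃_le_of_bound`). [cite: GigaGigaSaal2010, §1.1.3] -/
theorem norm_heatExtension_lift_lineDeriv₄_le_of_bound {g : UnitAddTorus d → F}
    (hg : FunctionSpaces.Torus.IsSmooth g) {B : ℝ} (hB : ∀ z, ‖g z‖ ≤ B) {a : ℝ} (ha : 0 < a)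
    (x v₀ v₁ v₂ v₃ : EuclideanSpace ℝ d) :
    ‖heatExtension (FunctionSpaces.Torus.lift (fun z₀ => FunctionSpaces.Torus.lineDeriv
        (fun z => FunctionSpaces.Torus.lineDeriv (fun z' => FunctionSpaces.Torus.lineDeriv
          (fun z'' => FunctionSpaces.Torus.lineDeriv g z'' v₃) z' v₂) z v₁) z₀ v₀))
        (a + a + a + a) x‖ ≤
      (2 : ℝ) ^ ((Module.finrank ℝ (EuclideanSpace ℝ d) : ℝ) / 2) * a ^ (-(1 / 2 : ℝ)) *
        ((2 : ℝ) ^ ((Module.finrank ℝ (EuclideanSpace ℝ d) : ℝ) / 2) * a ^ (-(1 / 2 : ℝ)) *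
          ((2 : ℝ) ^ ((Module.finrank ℝ (EuclideanSpace ℝ d) : ℝ) / 2) * a ^ (-(1 / 2 : ℝ)) *
            ((2 : ℝ) ^ ((Module.finrank ℝ (EuclideanSpace ℝ d) : ℝ) / 2) * a ^ (-(1 / 2 : ℝ)) * B * ‖v₃‖) *
              ‖v₂‖) * ‖v₁‖) * ‖v₀‖ := by
  have h123 := ((hg.lineDeriv v₃).lineDeriv v₂).lineDeriv v₁
  have haaa : 0 < a + a + a := by linarith
  exact norm_heatExtension_lift_lineDeriv_le_step h123 haaa ha
    (fun y => norm_heatExtension_lift_lineDeriv₃_le_of_bound hg hB ha y v₁ v₂ v₃) x v₀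

/-- `((1/4)^{-1/2})⁴ = 16`. [folklore] -/
theorem rpow_quarter_aux : ((1 / 4 : ℝ) ^ (-(1 / 2 : ℝ))) ^ 4 = 16 := by
  rw [← Real.rpow_natCast, ← Real.rpow_mul (by norm_num)]
  rw [show (-(1 / 2 : ℝ)) * ((4 : ℕ) : ℝ) = -(2 : ℝ) by norm_num, Real.rpow_neg (by norm_num)]
  norm_num

/-- **The far field is bounded** (third derivatives): for a smooth torus function `u` with
`‖u‖ ≤ B`, `‖e^{1·Δ} (∂₁∂₂∂₃ u)~ (x)‖ ≤ 3^{3/2} 2^{3n/2} B ‖v₁‖ ‖v₂‖ ‖v₃‖`.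
[cite: GigaGigaSaal2010, §1.1.3] -/
theorem norm_heatExtension_one_lift_lineDeriv₃_le {u : UnitAddTorus d → F}
    (hu : FunctionSpaces.Torus.IsSmooth u) {B : ℝ} (hB : ∀ z, ‖u z‖ ≤ B) (x v₁ v₂ v₃ : EuclideanSpace ℝ d) :
    ‖heatExtension (FunctionSpaces.Torus.lift (fun z => FunctionSpaces.Torus.lineDeriv
        (fun z' => FunctionSpaces.Torus.lineDeriv (fun z'' => FunctionSpaces.Torus.lineDeriv u z'' v₃) z' v₂) z v₁))
        1 x‖ ≤
      (3 : ℝ) ^ ((3 : ℝ) / 2) * ((2 : ℝ) ^ ((Module.finrank ℝ (EuclideanSpace ℝ d) : ℝ) / 2)) ^ 3 * B *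
        ‖v₁‖ * ‖v₂‖ * ‖v₃‖ := by
  set c : ℝ := (2 : ℝ) ^ ((Module.finrank ℝ (EuclideanSpace ℝ d) : ℝ) / 2) with hc
  have h13 : (0 : ℝ) < 1 / 3 := by norm_num
  have h := norm_heatExtension_lift_lineDeriv₃_le_of_bound hu hB h13 x v₁ v₂ v₃
  rw [show (1 / 3 : ℝ) + 1 / 3 + 1 / 3 = 1 by norm_num, ← hc] at h
  refine h.trans_eq ?_
  have h3 : ((1 / 3 : ℝ) ^ (-(1 / 2 : ℝ))) ^ 3 = (3 : ℝ) ^ ((3 : ℝ) / 2) := by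
    have := rpow_div_three_aux one_pos
    rwa [Real.one_rpow, mul_one] at this
  calc c * (1 / 3 : ℝ) ^ (-(1 / 2 : ℝ)) * (c * (1 / 3 : ℝ) ^ (-(1 / 2 : ℝ)) *
        (c * (1 / 3 : ℝ) ^ (-(1 / 2 : ℝ)) * B * ‖v₃‖) * ‖v₂‖) * ‖v₁‖
      = ((1 / 3 : ℝ) ^ (-(1 / 2 : ℝ))) ^ 3 * c ^ 3 * B * ‖v₁‖ * ‖v₂‖ * ‖v₃‖ := by ring
    _ = (3 : ℝ) ^ ((3 : ℝ) / 2) * c ^ 3 * B * ‖v₁‖ * ‖v₂‖ * ‖v₃‖ := by rw [h3]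

/-- **The far field is Lipschitz** (third derivatives): for a smooth torus function `u` with
`‖u‖ ≤ B`, the function `e^{1·Δ} (∂₁∂₂∂₃ u)~` has derivative bounded by
`16 · 2^{2n} B ‖v₁‖ ‖v₂‖ ‖v₃‖` (fourth-order smoothing bound at `a = 1/4`), hence
`‖e^{Δ}(∂³u)~(x) - e^{Δ}(∂³u)~(y)‖ ≤ 16 · 2^{2n} B ‖v₁‖ ‖v₂‖ ‖v₃‖ ‖x - y‖`.
[cite: GigaGigaSaal2010, §1.1.3] -/
theorem norm_heatExtension_one_lift_lineDeriv₃_sub_le {u : UnitAddTorus d → F}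
    (hu : FunctionSpaces.Torus.IsSmooth u) {B : ℝ} (hB : ∀ z, ‖u z‖ ≤ B) (v₁ v₂ v₃ x y : EuclideanSpace ℝ d) :
    ‖heatExtension (FunctionSpaces.Torus.lift (fun z => FunctionSpaces.Torus.lineDeriv
        (fun z' => FunctionSpaces.Torus.lineDeriv (fun z'' => FunctionSpaces.Torus.lineDeriv u z'' v₃) z' v₂) z v₁))
        1 x -
      heatExtension (FunctionSpaces.Torus.lift (fun z => FunctionSpaces.Torus.lineDeriv
        (fun z' => FunctionSpaces.Torus.lineDeriv (fun z'' => FunctionSpaces.Torus.lineDeriv u z'' v₃) z' v₂) z v₁))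
        1 y‖ ≤
      16 * ((2 : ℝ) ^ ((Module.finrank ℝ (EuclideanSpace ℝ d) : ℝ) / 2)) ^ 4 * B *
        ‖v₁‖ * ‖v₂‖ * ‖v₃‖ * ‖x - y‖ := by
  set c : ℝ := (2 : ℝ) ^ ((Module.finrank ℝ (EuclideanSpace ℝ d) : ℝ) / 2) with hc
  set g : UnitAddTorus d → F := fun z => FunctionSpaces.Torus.lineDeriv
    (fun z' => FunctionSpaces.Torus.lineDeriv (fun z'' => FunctionSpaces.Torus.lineDeriv u z'' v₃) z' v₂) z v₁
    with hg_def
  have hg : FunctionSpaces.Torus.IsSmooth g := ((hu.lineDeriv v₃).lineDeriv v₂).lineDeriv v₁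
  set P : EuclideanSpace ℝ d → F := heatExtension (FunctionSpaces.Torus.lift g) 1 with hP
  have hPd : ∀ z, DifferentiableAt ℝ P z := fun z =>
    ((contDiff_heatExtension_lift hg.continuous one_pos (m := 1)).differentiable one_ne_zero) z
  have hB0 : 0 ≤ B := (norm_nonneg _).trans (hB 0)
  have hbound : ∀ z, ‖fderiv ℝ P z‖ ≤ 16 * c ^ 4 * B * ‖v₁‖ * ‖v₂‖ * ‖v₃‖ := by
    intro z
    refine ContinuousLinearMap.opNorm_le_bound _ (by positivity) fun v => ?_
    rw [hP, fderiv_heatExtension_lift_apply hg one_pos z v]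
    have h14 : (0 : ℝ) < 1 / 4 := by norm_num
    have h := norm_heatExtension_lift_lineDeriv₄_le_of_bound hu hB h14 z v v₁ v₂ v₃
    rw [show (1 / 4 : ℝ) + 1 / 4 + 1 / 4 + 1 / 4 = 1 by norm_num, ← hc] at h
    refine h.trans_eq ?_
    calc c * (1 / 4 : ℝ) ^ (-(1 / 2 : ℝ)) * (c * (1 / 4 : ℝ) ^ (-(1 / 2 : ℝ)) *
        (c * (1 / 4 : ℝ) ^ (-(1 / 2 : ℝ)) * (c * (1 / 4 : ℝ) ^ (-(1 / 2 : ℝ)) * B * ‖v₃‖) * ‖v₂‖) * ‖v₁‖) * ‖v‖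
        = ((1 / 4 : ℝ) ^ (-(1 / 2 : ℝ))) ^ 4 * c ^ 4 * B * ‖v₁‖ * ‖v₂‖ * ‖v₃‖ * ‖v‖ := by ring
      _ = 16 * c ^ 4 * B * ‖v₁‖ * ‖v₂‖ * ‖v₃‖ * ‖v‖ := by rw [rpow_quarter_aux]
  have := Convex.norm_image_sub_le_of_norm_fderiv_le (fun z _ => hPd z) (fun z _ => hbound z)
    convex_univ (mem_univ y) (mem_univ x)
  exact this

end Smoothing


/-! ## The near field for Hölder data: size of the third derivatives -/

section NearHeat

variable {d : Type*} [Fintype d]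
variable {F : Type*} [NormedAddCommGroup F] [NormedSpace ℝ F] [CompleteSpace F]

/-- **Near-field size of third derivatives**: for smooth `G` with `‖G̃ y - G̃ z‖ ≤ A ‖y - z‖^β`
(`0 ≤ β ≤ 1`) and `0 < σ`,
`‖e^{σΔ}(∂₁∂₂∂₃G)~(x)‖ ≤ 2^{3n/2}(1+2·2^{n/2})(2^{β/2}/3^{β/2}·3^{3/2}) A ‖v₁‖‖v₂‖‖v₃‖ σ^{(β-3)/2}`.
[cite: BuckmasterEtAl2018, §2.2 (standard mollification estimates)] -/
theorem norm_heatExtension_lift_lineDeriv₃_le_rpow {G : UnitAddTorus d → F}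
    (hG : FunctionSpaces.Torus.IsSmooth G) {A β : ℝ} (hA : 0 ≤ A) (hβ0 : 0 ≤ β) (hβ1 : β ≤ 1)
    (hH : ∀ y z, ‖FunctionSpaces.Torus.lift G y - FunctionSpaces.Torus.lift G z‖ ≤ A * ‖y - z‖ ^ β)
    {σ : ℝ} (hσ : 0 < σ) (x v₁ v₂ v₃ : EuclideanSpace ℝ d) :
    ‖heatExtension (FunctionSpaces.Torus.lift (fun z => FunctionSpaces.Torus.lineDeriv
        (fun z' => FunctionSpaces.Torus.lineDeriv (fun z'' => FunctionSpaces.Torus.lineDeriv G z'' v₃) z' v₂) z v₁))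
        σ x‖ ≤
      ((2 : ℝ) ^ ((Module.finrank ℝ (EuclideanSpace ℝ d) : ℝ) / 2)) ^ 3 *
        (1 + 2 * (2 : ℝ) ^ ((Module.finrank ℝ (EuclideanSpace ℝ d) : ℝ) / 2)) *
          ((2 : ℝ) ^ (β / 2) / (3 : ℝ) ^ (β / 2) * (3 : ℝ) ^ ((3 : ℝ) / 2)) * A * ‖v₁‖ * ‖v₂‖ * ‖v₃‖ *
            σ ^ ((β - 3) / 2) := by
  set c : ℝ := (2 : ℝ) ^ ((Module.finrank ℝ (EuclideanSpace ℝ d) : ℝ) / 2) with hc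
  set cH : ℝ := 1 + 2 * (2 : ℝ) ^ ((Module.finrank ℝ (EuclideanSpace ℝ d) : ℝ) / 2) with hcH
  have h3 : 0 < σ / 3 := by positivity
  have h := norm_heatExtension_lift_lineDeriv₃_le_of_holder hG hA hβ0 hβ1 hH h3 x v₁ v₂ v₃
  rw [show σ / 3 + σ / 3 + σ / 3 = σ by ring, ← hc, ← hcH] at h
  refine h.trans_eq ?_
  calc c * (σ / 3) ^ (-(1 / 2 : ℝ)) * (c * (σ / 3) ^ (-(1 / 2 : ℝ)) *
        (c * (σ / 3) ^ (-(1 / 2 : ℝ)) * (cH * (2 * (σ / 3)) ^ (β / 2)) * A * ‖v₃‖) * ‖v₂‖) * ‖v₁‖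
      = c ^ 3 * cH * ((2 * (σ / 3)) ^ (β / 2) * ((σ / 3) ^ (-(1 / 2 : ℝ))) ^ 3) * A * ‖v₁‖ * ‖v₂‖ * ‖v₃‖ := by
        ring
    _ = c ^ 3 * cH * ((2 : ℝ) ^ (β / 2) / (3 : ℝ) ^ (β / 2) * (3 : ℝ) ^ ((3 : ℝ) / 2)) * A * ‖v₁‖ * ‖v₂‖ *
          ‖v₃‖ * σ ^ ((β - 3) / 2) := by
        rw [rpow_div_three_aux' hσ β]; ring

/-- `(σ/n)^r = (1/n)^r σ^r` for `0 < σ`, `0 < n`. [folklore] -/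
theorem div_rpow_eq_mul_rpow {σ n : ℝ} (hσ : 0 < σ) (hn : 0 < n) (r : ℝ) :
    (σ / n) ^ r = (1 / n) ^ r * σ ^ r := by
  rw [show σ / n = (1 / n) * σ by ring, Real.mul_rpow (by positivity) hσ.le]

end NearHeat

/-! ## The commutator estimate -/

section Commutator

variable {F : Type*} [NormedAddCommGroup F] [NormedSpace ℝ F] [CompleteSpace F]

set_option maxHeartbeats 1600000 in
/-- **Hölder estimate for the commutator of a third derivative of the inverse Laplacian with a
multiplication, through the heat semigroup.** For `0 < β < 1` there is `K = K(d, β) ≥ 0` such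
that: whenever `m` (real) and `G, p, q` are smooth on `T^d` with
`Δ(∂₁∂₂∂₃ p) = ∂₁∂₂∂₃ (m G)` and `Δ(∂₁∂₂∂₃ q) = ∂₁∂₂∂₃ G` on `T^d` (`∂₁∂₂∂₃ = ∂_{v₁}∂_{v₂}∂_{v₃}`;
for `∂ᵢ∂ⱼ∂ₖΔ⁻¹` on `T³`: `p = Δ⁻¹(mG)`, `q = Δ⁻¹G`), `‖p‖ ≤ B_p`, `‖q‖ ≤ B_q`, `‖m‖ ≤ C_m`,
`‖∇m̃‖ ≤ L`, `‖∇m̃(y) - ∇m̃(z)‖ ≤ L'‖y - z‖^β`, `‖G‖ ≤ M`, `‖G̃ y - G̃ z‖ ≤ A ‖y - z‖^β`, the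
commutator `Q = (∂₁∂₂∂₃p)~ - m̃ (∂₁∂₂∂₃q)~` obeys
`‖Q x‖ ≤ K S ‖v₁‖‖v₂‖‖v₃‖` and `‖Q x - Q y‖ ≤ K S ‖v₁‖‖v₂‖‖v₃‖ ‖x - y‖^β` with
`S = B_p + (C_m + L) B_q + (L A + L' M)`. For `T₃ = ∂ᵢ∂ⱼ∂ₖΔ⁻¹` on `T³` this is the `C^β` bound
`‖T₃(mG) - m T₃G‖_{C^β} ≲ ‖m‖_{C^{1,β}} ‖G‖_{C^β}` behind BDSV 2019, App. D, Prop. D.1 (with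
`sup|Δ⁻¹h| ≲ sup|h|`). Proof: `(∂³p)~ = e^{Δ}(∂³p)~ - ∫₀¹ e^{σΔ}(∂³(mG))~ dσ` and the same for `q`
(`lift_eq_heatExtension_one_sub_integral`); the far field `e^{Δ}(∂³p)~ - m̃ e^{Δ}(∂³q)~` by the
third/fourth-order smoothing bounds of bounded data; the near-field integrand
`[∂³e^{σΔ}, m̃]G̃` has size `≲ σ^{β/2-1}` (`exists_norm_heatCommutator₃_le`) and Lipschitz constant
`≲ σ^{(β-3)/2}` (`exists_norm_heatCommutator₄_le` and `∇m̃ ⊗ ∂³e^{σΔ}G̃`), so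
`norm_integral_Ioc_sub_le_of_bounds` applies. [cite: BuckmasterEtAl2018, App. D Prop. D.1] -/
theorem exists_holder_bound_commutator₃ (d : Type*) [Fintype d] {β : ℝ} (hβ0 : 0 < β) (hβ1 : β < 1) :
    ∃ K : ℝ, 0 ≤ K ∧
      ∀ {m : UnitAddTorus d → ℝ} {G p q : UnitAddTorus d → F}
        (_hm : FunctionSpaces.Torus.IsSmooth m) (_hG : FunctionSpaces.Torus.IsSmooth G)
        (_hp : FunctionSpaces.Torus.IsSmooth p) (_hq : FunctionSpaces.Torus.IsSmooth q)
        (v₁ v₂ v₃ : EuclideanSpace ℝ d)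
        (_hΔp : ∀ z, FunctionSpaces.Torus.laplacian (fun z => FunctionSpaces.Torus.lineDeriv
            (fun z' => FunctionSpaces.Torus.lineDeriv (fun z'' => FunctionSpaces.Torus.lineDeriv p z'' v₃) z' v₂) z v₁) z =
          FunctionSpaces.Torus.lineDeriv (fun z' => FunctionSpaces.Torus.lineDeriv
            (fun z'' => FunctionSpaces.Torus.lineDeriv (fun w => m w • G w) z'' v₃) z' v₂) z v₁)
        (_hΔq : ∀ z, FunctionSpaces.Torus.laplacian (fun z => FunctionSpaces.Torus.lineDeriv
            (fun z' => FunctionSpaces.Torus.lineDeriv (fun z'' => FunctionSpaces.Torus.lineDeriv q z'' v₃) z' v₂) z v₁) z =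
          FunctionSpaces.Torus.lineDeriv (fun z' => FunctionSpaces.Torus.lineDeriv
            (fun z'' => FunctionSpaces.Torus.lineDeriv G z'' v₃) z' v₂) z v₁)
        {Bp : ℝ} (_hBp : ∀ z, ‖p z‖ ≤ Bp) {Bq : ℝ} (_hBq : ∀ z, ‖q z‖ ≤ Bq)
        {Cm : ℝ} (_hCm : ∀ z, ‖m z‖ ≤ Cm)
        {L : ℝ} (_hL : ∀ y, ‖fderiv ℝ (FunctionSpaces.Torus.lift m) y‖ ≤ L)
        {L' : ℝ} (_hL' : 0 ≤ L')
        (_hLH : ∀ y z, ‖fderiv ℝ (FunctionSpaces.Torus.lift m) y - fderiv ℝ (FunctionSpaces.Torus.lift m) z‖ ≤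
          L' * ‖y - z‖ ^ β)
        {M : ℝ} (_hM : ∀ z, ‖G z‖ ≤ M) {A : ℝ} (_hA : 0 ≤ A)
        (_hH : ∀ y z, ‖FunctionSpaces.Torus.lift G y - FunctionSpaces.Torus.lift G z‖ ≤ A * ‖y - z‖ ^ β),
        (∀ x, ‖FunctionSpaces.Torus.lift (fun z => FunctionSpaces.Torus.lineDeriv
              (fun z' => FunctionSpaces.Torus.lineDeriv (fun z'' => FunctionSpaces.Torus.lineDeriv p z'' v₃) z' v₂) z v₁) x -
            FunctionSpaces.Torus.lift m x • FunctionSpaces.Torus.lift (fun z => FunctionSpaces.Torus.lineDeriv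
              (fun z' => FunctionSpaces.Torus.lineDeriv (fun z'' => FunctionSpaces.Torus.lineDeriv q z'' v₃) z' v₂) z v₁) x‖ ≤
            K * (Bp + (Cm + L) * Bq + (L * A + L' * M)) * ‖v₁‖ * ‖v₂‖ * ‖v₃‖) ∧
        (∀ x y, ‖(FunctionSpaces.Torus.lift (fun z => FunctionSpaces.Torus.lineDeriv
              (fun z' => FunctionSpaces.Torus.lineDeriv (fun z'' => FunctionSpaces.Torus.lineDeriv p z'' v₃) z' v₂) z v₁) x -
            FunctionSpaces.Torus.lift m x • FunctionSpaces.Torus.lift (fun z => FunctionSpaces.Torus.lineDeriv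
              (fun z' => FunctionSpaces.Torus.lineDeriv (fun z'' => FunctionSpaces.Torus.lineDeriv q z'' v₃) z' v₂) z v₁) x) -
            (FunctionSpaces.Torus.lift (fun z => FunctionSpaces.Torus.lineDeriv
              (fun z' => FunctionSpaces.Torus.lineDeriv (fun z'' => FunctionSpaces.Torus.lineDeriv p z'' v₃) z' v₂) z v₁) y -
            FunctionSpaces.Torus.lift m y • FunctionSpaces.Torus.lift (fun z => FunctionSpaces.Torus.lineDeriv
              (fun z' => FunctionSpaces.Torus.lineDeriv (fun z'' => FunctionSpaces.Torus.lineDeriv q z'' v₃) z' v₂) z v₁) y)‖ ≤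
            K * (Bp + (Cm + L) * Bq + (L * A + L' * M)) * ‖v₁‖ * ‖v₂‖ * ‖v₃‖ * ‖x - y‖ ^ β) := by
  -- the constants
  set c : ℝ := (2 : ℝ) ^ ((Module.finrank ℝ (EuclideanSpace ℝ d) : ℝ) / 2) with hc
  set cH : ℝ := 1 + 2 * (2 : ℝ) ^ ((Module.finrank ℝ (EuclideanSpace ℝ d) : ℝ) / 2) with hcH
  have hc0 : 0 < c := Real.rpow_pos_of_pos two_pos _
  have hcH0 : 0 < cH := by rw [hcH]; positivity
  have h1β : 0 < 1 - β := by linarith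
  obtain ⟨K₃, hK₃0, hK₃⟩ := exists_norm_heatCommutator₃_le (E := EuclideanSpace ℝ d) (F := F) hβ0.le hβ1.le
  obtain ⟨K₄, hK₄0, hK₄⟩ := exists_norm_heatCommutator₄_le (E := EuclideanSpace ℝ d) (F := F) hβ0.le hβ1.le
  -- far field: sup `P0`, Lipschitz `P1`; near field: size `K2 σ^{β/2-1}`, gradient `K3 σ^{(β-3)/2}`
  set P0 : ℝ := (3 : ℝ) ^ ((3 : ℝ) / 2) * c ^ 3 with hP0
  set P1 : ℝ := 16 * c ^ 4 with hP1
  set θ₃ : ℝ := (1 / 3 : ℝ) ^ (β / 2 - 1) with hθ₃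
  set θ₄ : ℝ := (1 / 4 : ℝ) ^ ((β - 3) / 2) with hθ₄
  set P3 : ℝ := c ^ 3 * cH * ((2 : ℝ) ^ (β / 2) / (3 : ℝ) ^ (β / 2) * (3 : ℝ) ^ ((3 : ℝ) / 2)) with hP3
  set K2 : ℝ := K₃ * θ₃ with hK2
  set K3 : ℝ := K₄ * θ₄ + P3 with hK3
  have hP00 : 0 ≤ P0 := by positivity
  have hP10 : 0 ≤ P1 := by positivity
  have hθ₃0 : 0 < θ₃ := Real.rpow_pos_of_pos (by norm_num) _
  have hθ₄0 : 0 < θ₄ := Real.rpow_pos_of_pos (by norm_num) _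
  have hP30 : 0 ≤ P3 := by positivity
  have hK20 : 0 ≤ K2 := by positivity
  have hK30 : 0 ≤ K3 := by positivity
  -- the Hölder constant of the near field and the total constant
  set KN : ℝ := 4 * K2 / β + 2 * K3 / (1 - β) with hKN
  have hKN0 : 0 ≤ KN := by positivity
  set K : ℝ := (P0 + P1 + 2 * P0) + (2 * K2 / β + KN) with hK
  have hK0 : 0 ≤ K := by positivity
  refine ⟨K, hK0, ?_⟩
  intro m G p q hm hG hp hq v₁ v₂ v₃ hΔp hΔq Bp hBp Bq hBq Cm hCm L hL L' hL' hLH M hM A hA hH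

  -- smoothness of the players
  have hmG : FunctionSpaces.Torus.IsSmooth (fun w => m w • G w) := hm.smul' hG
  have hg₁ : FunctionSpaces.Torus.IsSmooth (fun z => FunctionSpaces.Torus.lineDeriv (fun z' => FunctionSpaces.Torus.lineDeriv (fun z'' => FunctionSpaces.Torus.lineDeriv p z'' v₃) z' v₂) z v₁) := ((hp.lineDeriv v₃).lineDeriv v₂).lineDeriv v₁
  have hg₂ : FunctionSpaces.Torus.IsSmooth (fun z => FunctionSpaces.Torus.lineDeriv (fun z' => FunctionSpaces.Torus.lineDeriv (fun z'' => FunctionSpaces.Torus.lineDeriv q z'' v₃) z' v₂) z v₁) := ((hq.lineDeriv v₃).lineDeriv v₂).lineDeriv v₁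
  have hΨ₁ : FunctionSpaces.Torus.IsSmooth (fun z => FunctionSpaces.Torus.lineDeriv (fun z' => FunctionSpaces.Torus.lineDeriv (fun z'' => FunctionSpaces.Torus.lineDeriv (fun w => m w • G w) z'' v₃) z' v₂) z v₁) := ((hmG.lineDeriv v₃).lineDeriv v₂).lineDeriv v₁
  have hΨ₂ : FunctionSpaces.Torus.IsSmooth (fun z => FunctionSpaces.Torus.lineDeriv (fun z' => FunctionSpaces.Torus.lineDeriv (fun z'' => FunctionSpaces.Torus.lineDeriv G z'' v₃) z' v₂) z v₁) := ((hG.lineDeriv v₃).lineDeriv v₂).lineDeriv v₁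
  -- basic nonnegativity and lifted bounds
  have hBp0 : 0 ≤ Bp := (norm_nonneg _).trans (hBp 0)
  have hBq0 : 0 ≤ Bq := (norm_nonneg _).trans (hBq 0)
  have hCm0 : 0 ≤ Cm := (norm_nonneg _).trans (hCm 0)
  have hM0 : 0 ≤ M := (norm_nonneg _).trans (hM 0)
  have hL0 : 0 ≤ L := (norm_nonneg _).trans (hL 0)
  have hml : ∀ y, ‖FunctionSpaces.Torus.lift m y‖ ≤ Cm := fun y => hCm _
  have hGl : ∀ y, ‖FunctionSpaces.Torus.lift G y‖ ≤ M := fun y => hM _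
  have hm1 : ContDiff ℝ 1 (FunctionSpaces.Torus.lift m) := hm.of_le (by exact_mod_cast le_top)
  have hGc : Continuous (FunctionSpaces.Torus.lift G) := FunctionSpaces.Torus.continuous_lift_iff.2 hG.continuous
  have hLip : ∀ y z, ‖FunctionSpaces.Torus.lift m y - FunctionSpaces.Torus.lift m z‖ ≤ L * ‖y - z‖ := norm_sub_le_of_norm_fderiv_le hm1 hL
  have hliftmG : (fun z => FunctionSpaces.Torus.lift m z • FunctionSpaces.Torus.lift G z) = FunctionSpaces.Torus.lift (fun w => m w • G w) := rfl
  set n123 : ℝ := ‖v₁‖ * ‖v₂‖ * ‖v₃‖ with hn123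
  have hn0 : 0 ≤ n123 := by positivity
  have hS0 : 0 ≤ L * A + L' * M := by positivity
  -- the near-field family and its bounds
  set Φ : ℝ → EuclideanSpace ℝ d → F := fun σ x =>
    heatExtension (FunctionSpaces.Torus.lift (fun z => FunctionSpaces.Torus.lineDeriv (fun z' => FunctionSpaces.Torus.lineDeriv (fun z'' => FunctionSpaces.Torus.lineDeriv (fun w => m w • G w) z'' v₃) z' v₂) z v₁)) σ x - FunctionSpaces.Torus.lift m x • heatExtension (FunctionSpaces.Torus.lift (fun z => FunctionSpaces.Torus.lineDeriv (fun z' => FunctionSpaces.Torus.lineDeriv (fun z'' => FunctionSpaces.Torus.lineDeriv G z'' v₃) z' v₂) z v₁)) σ x with hΦ_def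
  have hΦc : ∀ x, ContinuousOn (fun σ => Φ σ x) (Ioi 0) := fun x =>
    (continuousOn_heatExtension_time (memLp_top_lift hΨ₁.continuous) le_top x).sub
      ((continuousOn_heatExtension_time (memLp_top_lift hΨ₂.continuous) le_top x).const_smul (FunctionSpaces.Torus.lift m x))
  have hΦb : ∀ σ ∈ Ioc (0 : ℝ) 1, ∀ x, ‖Φ σ x‖ ≤ K2 * (L * A + L' * M) * n123 * σ ^ (β / 2 - 1) := by
    intro σ hσ x
    have hσ0 : 0 < σ := hσ.1
    have ha : 0 < σ / 3 := by positivity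
    have h := hK₃ hm1 hml hL hL' hLH hGc hGl hA hH ha x v₁ v₂ v₃
    have e₁ := heatExtension_lift_lineDeriv₃_eq hmG ha x v₁ v₂ v₃
    have e₂ := heatExtension_lift_lineDeriv₃_eq hG ha x v₁ v₂ v₃
    rw [show σ / 3 + σ / 3 + σ / 3 = σ by ring] at e₁ e₂
    rw [hliftmG, ← e₁, ← e₂] at h
    refine h.trans_eq ?_
    rw [div_rpow_eq_mul_rpow hσ0 three_pos, ← hθ₃, hK2, hn123]
    ring
  have hΦl : ∀ σ ∈ Ioc (0 : ℝ) 1, ∀ x y, ‖Φ σ x - Φ σ y‖ ≤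
      K3 * (L * A + L' * M) * n123 * σ ^ ((β - 3) / 2) * ‖x - y‖ := by
    intro σ hσ x y
    have hσ0 : 0 < σ := hσ.1
    have hPd : ∀ z, DifferentiableAt ℝ (heatExtension (FunctionSpaces.Torus.lift (fun z => FunctionSpaces.Torus.lineDeriv (fun z' => FunctionSpaces.Torus.lineDeriv (fun z'' => FunctionSpaces.Torus.lineDeriv (fun w => m w • G w) z'' v₃) z' v₂) z v₁)) σ) z := fun z =>
      ((contDiff_heatExtension_lift hΨ₁.continuous hσ0 (m := 1)).differentiable one_ne_zero) z
    have hRd : ∀ z, DifferentiableAt ℝ (heatExtension (FunctionSpaces.Torus.lift (fun z => FunctionSpaces.Torus.lineDeriv (fun z' => FunctionSpaces.Torus.lineDeriv (fun z'' => FunctionSpaces.Torus.lineDeriv G z'' v₃) z' v₂) z v₁)) σ) z := fun z =>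
      ((contDiff_heatExtension_lift hΨ₂.continuous hσ0 (m := 1)).differentiable one_ne_zero) z
    have hmd : ∀ z, DifferentiableAt ℝ (FunctionSpaces.Torus.lift m) z := fun z => (hm1.differentiable one_ne_zero) z
    -- the derivative of `Φ σ`
    have hderiv : ∀ z, HasFDerivAt (Φ σ)
        (fderiv ℝ (heatExtension (FunctionSpaces.Torus.lift (fun z => FunctionSpaces.Torus.lineDeriv (fun z' => FunctionSpaces.Torus.lineDeriv (fun z'' => FunctionSpaces.Torus.lineDeriv (fun w => m w • G w) z'' v₃) z' v₂) z v₁)) σ) z -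
          (FunctionSpaces.Torus.lift m z • fderiv ℝ (heatExtension (FunctionSpaces.Torus.lift (fun z => FunctionSpaces.Torus.lineDeriv (fun z' => FunctionSpaces.Torus.lineDeriv (fun z'' => FunctionSpaces.Torus.lineDeriv G z'' v₃) z' v₂) z v₁)) σ) z +
            (fderiv ℝ (FunctionSpaces.Torus.lift m) z).smulRight (heatExtension (FunctionSpaces.Torus.lift (fun z => FunctionSpaces.Torus.lineDeriv (fun z' => FunctionSpaces.Torus.lineDeriv (fun z'' => FunctionSpaces.Torus.lineDeriv G z'' v₃) z' v₂) z v₁)) σ z))) z := fun z =>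
      (hPd z).hasFDerivAt.sub ((hmd z).hasFDerivAt.smul (hRd z).hasFDerivAt)
    -- the third derivative of the heat flow of `G`
    have hRb : ∀ z, ‖heatExtension (FunctionSpaces.Torus.lift (fun z => FunctionSpaces.Torus.lineDeriv (fun z' => FunctionSpaces.Torus.lineDeriv (fun z'' => FunctionSpaces.Torus.lineDeriv G z'' v₃) z' v₂) z v₁)) σ z‖ ≤ P3 * A * n123 * σ ^ ((β - 3) / 2) := fun z => by
      have h := norm_heatExtension_lift_lineDeriv₃_le_rpow hG hA hβ0.le hβ1.le hH hσ0 z v₁ v₂ v₃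
      rw [← hc, ← hcH] at h
      refine h.trans_eq ?_
      rw [hP3, hn123]; ring
    -- the commutator part of the derivative
    have hcomm : ∀ z v, ‖fderiv ℝ (heatExtension (FunctionSpaces.Torus.lift (fun z => FunctionSpaces.Torus.lineDeriv (fun z' => FunctionSpaces.Torus.lineDeriv (fun z'' => FunctionSpaces.Torus.lineDeriv (fun w => m w • G w) z'' v₃) z' v₂) z v₁)) σ) z v -
        FunctionSpaces.Torus.lift m z • fderiv ℝ (heatExtension (FunctionSpaces.Torus.lift (fun z => FunctionSpaces.Torus.lineDeriv (fun z' => FunctionSpaces.Torus.lineDeriv (fun z'' => FunctionSpaces.Torus.lineDeriv G z'' v₃) z' v₂) z v₁)) σ) z v‖ ≤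
        K₄ * θ₄ * (L * A + L' * M) * n123 * σ ^ ((β - 3) / 2) * ‖v‖ := fun z v => by
      have ha : 0 < σ / 4 := by positivity
      rw [fderiv_heatExtension_lift_apply hΨ₁ hσ0 z v, fderiv_heatExtension_lift_apply hΨ₂ hσ0 z v]
      have h := hK₄ hm1 hml hL hL' hLH hGc hGl hA hH ha z v v₁ v₂ v₃
      have e₁ := heatExtension_lift_lineDeriv₄_eq hmG ha z v v₁ v₂ v₃
      have e₂ := heatExtension_lift_lineDeriv₄_eq hG ha z v v₁ v₂ v₃
      rw [show σ / 4 + σ / 4 + σ / 4 + σ / 4 = σ by ring] at e₁ e₂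
      rw [hliftmG, ← e₁, ← e₂] at h
      refine h.trans_eq ?_
      rw [div_rpow_eq_mul_rpow hσ0 four_pos, ← hθ₄, hn123]
      ring
    have hLipσ : 0 ≤ K3 * (L * A + L' * M) * n123 * σ ^ ((β - 3) / 2) := by positivity
    have hbound : ∀ z, ‖fderiv ℝ (Φ σ) z‖ ≤ K3 * (L * A + L' * M) * n123 * σ ^ ((β - 3) / 2) := by
      intro z
      rw [(hderiv z).fderiv]
      refine ContinuousLinearMap.opNorm_le_bound _ hLipσ fun v => ?_
      have h1 := hcomm z v
      have h2 : ‖(fderiv ℝ (FunctionSpaces.Torus.lift m) z v) • heatExtension (FunctionSpaces.Torus.lift (fun z => FunctionSpaces.Torus.lineDeriv (fun z' => FunctionSpaces.Torus.lineDeriv (fun z'' => FunctionSpaces.Torus.lineDeriv G z'' v₃) z' v₂) z v₁)) σ z‖ ≤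
          L * ‖v‖ * (P3 * A * n123 * σ ^ ((β - 3) / 2)) := by
        rw [norm_smul]
        refine mul_le_mul ?_ (hRb z) (norm_nonneg _) (by positivity)
        exact (ContinuousLinearMap.le_opNorm _ _).trans (mul_le_mul_of_nonneg_right (hL z) (norm_nonneg _))
      have hLA : L * (P3 * A) ≤ P3 * (L * A + L' * M) := by nlinarith [mul_nonneg hL' hM0, hP30]
      calc ‖(fderiv ℝ (heatExtension (FunctionSpaces.Torus.lift (fun z => FunctionSpaces.Torus.lineDeriv (fun z' => FunctionSpaces.Torus.lineDeriv (fun z'' => FunctionSpaces.Torus.lineDeriv (fun w => m w • G w) z'' v₃) z' v₂) z v₁)) σ) z -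
              (FunctionSpaces.Torus.lift m z • fderiv ℝ (heatExtension (FunctionSpaces.Torus.lift (fun z => FunctionSpaces.Torus.lineDeriv (fun z' => FunctionSpaces.Torus.lineDeriv (fun z'' => FunctionSpaces.Torus.lineDeriv G z'' v₃) z' v₂) z v₁)) σ) z +
                (fderiv ℝ (FunctionSpaces.Torus.lift m) z).smulRight (heatExtension (FunctionSpaces.Torus.lift (fun z => FunctionSpaces.Torus.lineDeriv (fun z' => FunctionSpaces.Torus.lineDeriv (fun z'' => FunctionSpaces.Torus.lineDeriv G z'' v₃) z' v₂) z v₁)) σ z))) v‖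
          = ‖(fderiv ℝ (heatExtension (FunctionSpaces.Torus.lift (fun z => FunctionSpaces.Torus.lineDeriv (fun z' => FunctionSpaces.Torus.lineDeriv (fun z'' => FunctionSpaces.Torus.lineDeriv (fun w => m w • G w) z'' v₃) z' v₂) z v₁)) σ) z v -
              FunctionSpaces.Torus.lift m z • fderiv ℝ (heatExtension (FunctionSpaces.Torus.lift (fun z => FunctionSpaces.Torus.lineDeriv (fun z' => FunctionSpaces.Torus.lineDeriv (fun z'' => FunctionSpaces.Torus.lineDeriv G z'' v₃) z' v₂) z v₁)) σ) z v) -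
              (fderiv ℝ (FunctionSpaces.Torus.lift m) z v) • heatExtension (FunctionSpaces.Torus.lift (fun z => FunctionSpaces.Torus.lineDeriv (fun z' => FunctionSpaces.Torus.lineDeriv (fun z'' => FunctionSpaces.Torus.lineDeriv G z'' v₃) z' v₂) z v₁)) σ z‖ := by
            congr 1
            simp only [sub_apply, add_apply, smul_apply, ContinuousLinearMap.smulRight_apply]
            abel
        _ ≤ ‖fderiv ℝ (heatExtension (FunctionSpaces.Torus.lift (fun z => FunctionSpaces.Torus.lineDeriv (fun z' => FunctionSpaces.Torus.lineDeriv (fun z'' => FunctionSpaces.Torus.lineDeriv (fun w => m w • G w) z'' v₃) z' v₂) z v₁)) σ) z v -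
              FunctionSpaces.Torus.lift m z • fderiv ℝ (heatExtension (FunctionSpaces.Torus.lift (fun z => FunctionSpaces.Torus.lineDeriv (fun z' => FunctionSpaces.Torus.lineDeriv (fun z'' => FunctionSpaces.Torus.lineDeriv G z'' v₃) z' v₂) z v₁)) σ) z v‖ +
              ‖(fderiv ℝ (FunctionSpaces.Torus.lift m) z v) • heatExtension (FunctionSpaces.Torus.lift (fun z => FunctionSpaces.Torus.lineDeriv (fun z' => FunctionSpaces.Torus.lineDeriv (fun z'' => FunctionSpaces.Torus.lineDeriv G z'' v₃) z' v₂) z v₁)) σ z‖ := norm_sub_le _ _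
        _ ≤ K₄ * θ₄ * (L * A + L' * M) * n123 * σ ^ ((β - 3) / 2) * ‖v‖ +
              L * ‖v‖ * (P3 * A * n123 * σ ^ ((β - 3) / 2)) := add_le_add h1 h2
        _ = (K₄ * θ₄ * (L * A + L' * M) + L * (P3 * A)) * n123 * σ ^ ((β - 3) / 2) * ‖v‖ := by ring
        _ ≤ (K₄ * θ₄ * (L * A + L' * M) + P3 * (L * A + L' * M)) * n123 * σ ^ ((β - 3) / 2) * ‖v‖ := by
            have hσr : 0 ≤ σ ^ ((β - 3) / 2) := Real.rpow_nonneg hσ0.le _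
            gcongr
        _ = K3 * (L * A + L' * M) * n123 * σ ^ ((β - 3) / 2) * ‖v‖ := by rw [hK3]; ring
    have := Convex.norm_image_sub_le_of_norm_fderiv_le (fun z _ => (hderiv z).differentiableAt)
      (fun z _ => hbound z) convex_univ (mem_univ y) (mem_univ x)
    exact this

  have hKA : 0 ≤ K2 * (L * A + L' * M) * n123 := by positivity
  have hLA : 0 ≤ K3 * (L * A + L' * M) * n123 := by positivity
  -- near field: integrability, size and Hölder bound
  have hN : ∀ x, IntegrableOn (fun σ => Φ σ x) (Ioc 0 1) ∧
      ‖∫ σ in Ioc 0 1, Φ σ x‖ ≤ K2 * (L * A + L' * M) * n123 / (β / 2) := fun x =>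
    norm_integral_Ioc_le_of_norm_le_rpow (hΦc x) (by positivity) (fun σ hσ => hΦb σ hσ x)
  have hNH := norm_integral_Ioc_sub_le_of_bounds hβ0 hβ1 hKA hLA hΦc hΦb hΦl
  -- integrability of the two heat flows separately (bounded continuous integrands)
  have hint : ∀ {Ψ : UnitAddTorus d → F}, FunctionSpaces.Torus.IsSmooth Ψ → ∀ x,
      IntegrableOn (fun σ => heatExtension (FunctionSpaces.Torus.lift Ψ) σ x) (Ioc 0 1) := by
    intro Ψ hΨ x
    obtain ⟨C, -, hC⟩ := exists_norm_le hΨ.continuous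
    refine (norm_integral_Ioc_le_of_norm_le_rpow
      (continuousOn_heatExtension_time (memLp_top_lift hΨ.continuous) le_top x) one_pos
      (K := C) (fun σ hσ => ?_)).1
    rw [sub_self, Real.rpow_zero, mul_one]
    exact norm_heatExtension_lift_le hC hσ.1 x
  -- the representation of the commutator: far field minus near field
  have hrep₁ : ∀ x, FunctionSpaces.Torus.lift (fun z => FunctionSpaces.Torus.lineDeriv (fun z' => FunctionSpaces.Torus.lineDeriv (fun z'' => FunctionSpaces.Torus.lineDeriv p z'' v₃) z' v₂) z v₁) x = heatExtension (FunctionSpaces.Torus.lift (fun z => FunctionSpaces.Torus.lineDeriv (fun z' => FunctionSpaces.Torus.lineDeriv (fun z'' => FunctionSpaces.Torus.lineDeriv p z'' v₃) z' v₂) z v₁)) 1 x -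
      ∫ σ in Ioc 0 1, heatExtension (FunctionSpaces.Torus.lift (fun z => FunctionSpaces.Torus.lineDeriv (fun z' => FunctionSpaces.Torus.lineDeriv (fun z'' => FunctionSpaces.Torus.lineDeriv (fun w => m w • G w) z'' v₃) z' v₂) z v₁)) σ x := fun x =>
    lift_eq_heatExtension_one_sub_integral hg₁ (fun z => hΔp z) x (hint hΨ₁ x)
  have hrep₂ : ∀ x, FunctionSpaces.Torus.lift (fun z => FunctionSpaces.Torus.lineDeriv (fun z' => FunctionSpaces.Torus.lineDeriv (fun z'' => FunctionSpaces.Torus.lineDeriv q z'' v₃) z' v₂) z v₁) x = heatExtension (FunctionSpaces.Torus.lift (fun z => FunctionSpaces.Torus.lineDeriv (fun z' => FunctionSpaces.Torus.lineDeriv (fun z'' => FunctionSpaces.Torus.lineDeriv q z'' v₃) z' v₂) z v₁)) 1 x -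
      ∫ σ in Ioc 0 1, heatExtension (FunctionSpaces.Torus.lift (fun z => FunctionSpaces.Torus.lineDeriv (fun z' => FunctionSpaces.Torus.lineDeriv (fun z'' => FunctionSpaces.Torus.lineDeriv G z'' v₃) z' v₂) z v₁)) σ x := fun x =>
    lift_eq_heatExtension_one_sub_integral hg₂ (fun z => hΔq z) x (hint hΨ₂ x)
  have hΦint : ∀ x, (∫ σ in Ioc 0 1, Φ σ x) = (∫ σ in Ioc 0 1, heatExtension (FunctionSpaces.Torus.lift (fun z => FunctionSpaces.Torus.lineDeriv (fun z' => FunctionSpaces.Torus.lineDeriv (fun z'' => FunctionSpaces.Torus.lineDeriv (fun w => m w • G w) z'' v₃) z' v₂) z v₁)) σ x) -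
      FunctionSpaces.Torus.lift m x • ∫ σ in Ioc 0 1, heatExtension (FunctionSpaces.Torus.lift (fun z => FunctionSpaces.Torus.lineDeriv (fun z' => FunctionSpaces.Torus.lineDeriv (fun z'' => FunctionSpaces.Torus.lineDeriv G z'' v₃) z' v₂) z v₁)) σ x := by
    intro x
    simp only [hΦ_def]
    rw [integral_sub (hint hΨ₁ x) ((hint hΨ₂ x).fun_smul (FunctionSpaces.Torus.lift m x)), integral_smul]
  have hQ : ∀ x, FunctionSpaces.Torus.lift (fun z => FunctionSpaces.Torus.lineDeriv (fun z' => FunctionSpaces.Torus.lineDeriv (fun z'' => FunctionSpaces.Torus.lineDeriv p z'' v₃) z' v₂) z v₁) x - FunctionSpaces.Torus.lift m x • FunctionSpaces.Torus.lift (fun z => FunctionSpaces.Torus.lineDeriv (fun z' => FunctionSpaces.Torus.lineDeriv (fun z'' => FunctionSpaces.Torus.lineDeriv q z'' v₃) z' v₂) z v₁) x =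
      (heatExtension (FunctionSpaces.Torus.lift (fun z => FunctionSpaces.Torus.lineDeriv (fun z' => FunctionSpaces.Torus.lineDeriv (fun z'' => FunctionSpaces.Torus.lineDeriv p z'' v₃) z' v₂) z v₁)) 1 x - FunctionSpaces.Torus.lift m x • heatExtension (FunctionSpaces.Torus.lift (fun z => FunctionSpaces.Torus.lineDeriv (fun z' => FunctionSpaces.Torus.lineDeriv (fun z'' => FunctionSpaces.Torus.lineDeriv q z'' v₃) z' v₂) z v₁)) 1 x) -
        ∫ σ in Ioc 0 1, Φ σ x := by
    intro x
    rw [hΦint x, hrep₁ x, hrep₂ x, smul_sub]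
    abel
  -- far field bounds
  have hF0p : ∀ x, ‖heatExtension (FunctionSpaces.Torus.lift (fun z => FunctionSpaces.Torus.lineDeriv (fun z' => FunctionSpaces.Torus.lineDeriv (fun z'' => FunctionSpaces.Torus.lineDeriv p z'' v₃) z' v₂) z v₁)) 1 x‖ ≤ P0 * Bp * n123 := by
    intro x
    have h := norm_heatExtension_one_lift_lineDeriv₃_le hp hBp x v₁ v₂ v₃
    rw [← hc] at h
    refine h.trans_eq ?_
    rw [hP0, hn123]; ring
  have hF0q : ∀ x, ‖heatExtension (FunctionSpaces.Torus.lift (fun z => FunctionSpaces.Torus.lineDeriv (fun z' => FunctionSpaces.Torus.lineDeriv (fun z'' => FunctionSpaces.Torus.lineDeriv q z'' v₃) z' v₂) z v₁)) 1 x‖ ≤ P0 * Bq * n123 := by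
    intro x
    have h := norm_heatExtension_one_lift_lineDeriv₃_le hq hBq x v₁ v₂ v₃
    rw [← hc] at h
    refine h.trans_eq ?_
    rw [hP0, hn123]; ring
  have hF1p : ∀ x y, ‖heatExtension (FunctionSpaces.Torus.lift (fun z => FunctionSpaces.Torus.lineDeriv (fun z' => FunctionSpaces.Torus.lineDeriv (fun z'' => FunctionSpaces.Torus.lineDeriv p z'' v₃) z' v₂) z v₁)) 1 x - heatExtension (FunctionSpaces.Torus.lift (fun z => FunctionSpaces.Torus.lineDeriv (fun z' => FunctionSpaces.Torus.lineDeriv (fun z'' => FunctionSpaces.Torus.lineDeriv p z'' v₃) z' v₂) z v₁)) 1 y‖ ≤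
      P1 * Bp * n123 * ‖x - y‖ := by
    intro x y
    have h := norm_heatExtension_one_lift_lineDeriv₃_sub_le hp hBp v₁ v₂ v₃ x y
    rw [← hc] at h
    refine h.trans_eq ?_
    rw [hP1, hn123]; ring
  have hF1q : ∀ x y, ‖heatExtension (FunctionSpaces.Torus.lift (fun z => FunctionSpaces.Torus.lineDeriv (fun z' => FunctionSpaces.Torus.lineDeriv (fun z'' => FunctionSpaces.Torus.lineDeriv q z'' v₃) z' v₂) z v₁)) 1 x - heatExtension (FunctionSpaces.Torus.lift (fun z => FunctionSpaces.Torus.lineDeriv (fun z' => FunctionSpaces.Torus.lineDeriv (fun z'' => FunctionSpaces.Torus.lineDeriv q z'' v₃) z' v₂) z v₁)) 1 y‖ ≤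
      P1 * Bq * n123 * ‖x - y‖ := by
    intro x y
    have h := norm_heatExtension_one_lift_lineDeriv₃_sub_le hq hBq v₁ v₂ v₃ x y
    rw [← hc] at h
    refine h.trans_eq ?_
    rw [hP1, hn123]; ring
  -- the far field of the commutator
  set Far : EuclideanSpace ℝ d → F := fun x =>
    heatExtension (FunctionSpaces.Torus.lift (fun z => FunctionSpaces.Torus.lineDeriv (fun z' => FunctionSpaces.Torus.lineDeriv (fun z'' => FunctionSpaces.Torus.lineDeriv p z'' v₃) z' v₂) z v₁)) 1 x - FunctionSpaces.Torus.lift m x • heatExtension (FunctionSpaces.Torus.lift (fun z => FunctionSpaces.Torus.lineDeriv (fun z' => FunctionSpaces.Torus.lineDeriv (fun z'' => FunctionSpaces.Torus.lineDeriv q z'' v₃) z' v₂) z v₁)) 1 x with hFar_def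
  have hFar0 : ∀ x, ‖Far x‖ ≤ P0 * (Bp + Cm * Bq) * n123 := by
    intro x
    have h2 : ‖FunctionSpaces.Torus.lift m x • heatExtension (FunctionSpaces.Torus.lift (fun z => FunctionSpaces.Torus.lineDeriv (fun z' => FunctionSpaces.Torus.lineDeriv (fun z'' => FunctionSpaces.Torus.lineDeriv q z'' v₃) z' v₂) z v₁)) 1 x‖ ≤ Cm * (P0 * Bq * n123) := by
      rw [norm_smul]
      exact mul_le_mul (hml x) (hF0q x) (norm_nonneg _) hCm0
    calc ‖Far x‖ ≤ ‖heatExtension (FunctionSpaces.Torus.lift (fun z => FunctionSpaces.Torus.lineDeriv (fun z' => FunctionSpaces.Torus.lineDeriv (fun z'' => FunctionSpaces.Torus.lineDeriv p z'' v₃) z' v₂) z v₁)) 1 x‖ + ‖FunctionSpaces.Torus.lift m x • heatExtension (FunctionSpaces.Torus.lift (fun z => FunctionSpaces.Torus.lineDeriv (fun z' => FunctionSpaces.Torus.lineDeriv (fun z'' => FunctionSpaces.Torus.lineDeriv q z'' v₃) z' v₂) z v₁)) 1 x‖ :=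
          norm_sub_le _ _
      _ ≤ P0 * Bp * n123 + Cm * (P0 * Bq * n123) := add_le_add (hF0p x) h2
      _ = P0 * (Bp + Cm * Bq) * n123 := by ring
  have hFar1 : ∀ x y, ‖Far x - Far y‖ ≤ (P1 * Bp + (L * P0 + Cm * P1) * Bq) * n123 * ‖x - y‖ := by
    intro x y
    have e : Far x - Far y =
        (heatExtension (FunctionSpaces.Torus.lift (fun z => FunctionSpaces.Torus.lineDeriv (fun z' => FunctionSpaces.Torus.lineDeriv (fun z'' => FunctionSpaces.Torus.lineDeriv p z'' v₃) z' v₂) z v₁)) 1 x - heatExtension (FunctionSpaces.Torus.lift (fun z => FunctionSpaces.Torus.lineDeriv (fun z' => FunctionSpaces.Torus.lineDeriv (fun z'' => FunctionSpaces.Torus.lineDeriv p z'' v₃) z' v₂) z v₁)) 1 y) -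
          ((FunctionSpaces.Torus.lift m x - FunctionSpaces.Torus.lift m y) • heatExtension (FunctionSpaces.Torus.lift (fun z => FunctionSpaces.Torus.lineDeriv (fun z' => FunctionSpaces.Torus.lineDeriv (fun z'' => FunctionSpaces.Torus.lineDeriv q z'' v₃) z' v₂) z v₁)) 1 x +
            FunctionSpaces.Torus.lift m y • (heatExtension (FunctionSpaces.Torus.lift (fun z => FunctionSpaces.Torus.lineDeriv (fun z' => FunctionSpaces.Torus.lineDeriv (fun z'' => FunctionSpaces.Torus.lineDeriv q z'' v₃) z' v₂) z v₁)) 1 x - heatExtension (FunctionSpaces.Torus.lift (fun z => FunctionSpaces.Torus.lineDeriv (fun z' => FunctionSpaces.Torus.lineDeriv (fun z'' => FunctionSpaces.Torus.lineDeriv q z'' v₃) z' v₂) z v₁)) 1 y)) := by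
      simp only [hFar_def, sub_smul, smul_sub]
      abel
    have h2 : ‖(FunctionSpaces.Torus.lift m x - FunctionSpaces.Torus.lift m y) • heatExtension (FunctionSpaces.Torus.lift (fun z => FunctionSpaces.Torus.lineDeriv (fun z' => FunctionSpaces.Torus.lineDeriv (fun z'' => FunctionSpaces.Torus.lineDeriv q z'' v₃) z' v₂) z v₁)) 1 x‖ ≤
        L * ‖x - y‖ * (P0 * Bq * n123) := by
      rw [norm_smul]
      exact mul_le_mul (hLip x y) (hF0q x) (norm_nonneg _) (by positivity)
    have h3 : ‖FunctionSpaces.Torus.lift m y • (heatExtension (FunctionSpaces.Torus.lift (fun z => FunctionSpaces.Torus.lineDeriv (fun z' => FunctionSpaces.Torus.lineDeriv (fun z'' => FunctionSpaces.Torus.lineDeriv q z'' v₃) z' v₂) z v₁)) 1 x - heatExtension (FunctionSpaces.Torus.lift (fun z => FunctionSpaces.Torus.lineDeriv (fun z' => FunctionSpaces.Torus.lineDeriv (fun z'' => FunctionSpaces.Torus.lineDeriv q z'' v₃) z' v₂) z v₁)) 1 y)‖ ≤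
        Cm * (P1 * Bq * n123 * ‖x - y‖) := by
      rw [norm_smul]
      exact mul_le_mul (hml y) (hF1q x y) (norm_nonneg _) hCm0
    rw [e]
    calc _ ≤ ‖heatExtension (FunctionSpaces.Torus.lift (fun z => FunctionSpaces.Torus.lineDeriv (fun z' => FunctionSpaces.Torus.lineDeriv (fun z'' => FunctionSpaces.Torus.lineDeriv p z'' v₃) z' v₂) z v₁)) 1 x - heatExtension (FunctionSpaces.Torus.lift (fun z => FunctionSpaces.Torus.lineDeriv (fun z' => FunctionSpaces.Torus.lineDeriv (fun z'' => FunctionSpaces.Torus.lineDeriv p z'' v₃) z' v₂) z v₁)) 1 y‖ +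
            ‖(FunctionSpaces.Torus.lift m x - FunctionSpaces.Torus.lift m y) • heatExtension (FunctionSpaces.Torus.lift (fun z => FunctionSpaces.Torus.lineDeriv (fun z' => FunctionSpaces.Torus.lineDeriv (fun z'' => FunctionSpaces.Torus.lineDeriv q z'' v₃) z' v₂) z v₁)) 1 x +
              FunctionSpaces.Torus.lift m y • (heatExtension (FunctionSpaces.Torus.lift (fun z => FunctionSpaces.Torus.lineDeriv (fun z' => FunctionSpaces.Torus.lineDeriv (fun z'' => FunctionSpaces.Torus.lineDeriv q z'' v₃) z' v₂) z v₁)) 1 x - heatExtension (FunctionSpaces.Torus.lift (fun z => FunctionSpaces.Torus.lineDeriv (fun z' => FunctionSpaces.Torus.lineDeriv (fun z'' => FunctionSpaces.Torus.lineDeriv q z'' v₃) z' v₂) z v₁)) 1 y)‖ :=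
          norm_sub_le _ _
      _ ≤ P1 * Bp * n123 * ‖x - y‖ + (L * ‖x - y‖ * (P0 * Bq * n123) + Cm * (P1 * Bq * n123 * ‖x - y‖)) :=
          add_le_add (hF1p x y) ((norm_add_le _ _).trans (add_le_add h2 h3))
      _ = (P1 * Bp + (L * P0 + Cm * P1) * Bq) * n123 * ‖x - y‖ := by ring
  -- the far-field constants against `K`
  set SF : ℝ := Bp + (Cm + L) * Bq with hSF
  have hSF0 : 0 ≤ SF := by positivity
  have hcoef0 : P0 * (Bp + Cm * Bq) ≤ P0 * SF := by
    rw [hSF]; nlinarith [mul_nonneg hP00 (mul_nonneg hL0 hBq0)]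
  have hcoef1 : P1 * Bp + (L * P0 + Cm * P1) * Bq ≤ (P0 + P1) * SF := by
    rw [hSF]
    nlinarith [mul_nonneg hP00 hBp0, mul_nonneg hP00 (mul_nonneg hCm0 hBq0), mul_nonneg hP10 (mul_nonneg hL0 hBq0)]
  have hK2β : 0 ≤ 2 * K2 / β := by positivity
  have hKP0 : P0 ≤ K := by rw [hK]; linarith
  have hKfar : P0 + P1 + 2 * P0 ≤ K := by rw [hK]; linarith
  have hKK2 : 2 * K2 / β ≤ K := by rw [hK]; linarith
  have hKKN : KN ≤ K := by rw [hK]; linarith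
  refine ⟨fun x => ?_, fun x y => ?_⟩
  · -- sup bound
    rw [hQ x]
    have hcoef : P0 * SF + 2 * K2 / β * (L * A + L' * M) ≤ K * (SF + (L * A + L' * M)) := by
      have h1 : P0 * SF ≤ K * SF := mul_le_mul_of_nonneg_right hKP0 hSF0
      have h2 : 2 * K2 / β * (L * A + L' * M) ≤ K * (L * A + L' * M) := mul_le_mul_of_nonneg_right hKK2 hS0
      linarith
    calc ‖Far x - ∫ σ in Ioc 0 1, Φ σ x‖ ≤ ‖Far x‖ + ‖∫ σ in Ioc 0 1, Φ σ x‖ := norm_sub_le _ _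
      _ ≤ P0 * (Bp + Cm * Bq) * n123 + K2 * (L * A + L' * M) * n123 / (β / 2) := add_le_add (hFar0 x) (hN x).2
      _ ≤ P0 * SF * n123 + K2 * (L * A + L' * M) * n123 / (β / 2) := by
          gcongr
      _ = (P0 * SF + 2 * K2 / β * (L * A + L' * M)) * n123 := by rw [div_div_eq_mul_div]; ring
      _ ≤ K * (SF + (L * A + L' * M)) * n123 := mul_le_mul_of_nonneg_right hcoef hn0
      _ = K * (Bp + (Cm + L) * Bq + (L * A + L' * M)) * ‖v₁‖ * ‖v₂‖ * ‖v₃‖ := by rw [hSF, hn123]; ring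
  · -- Hölder bound
    set h : ℝ := ‖x - y‖ with hh_def
    have hh0 : 0 ≤ h := norm_nonneg _
    -- far field is `β`-Hölder with constant `(P0 + P1 + 2 P0) SF n123`
    have hfar : ‖Far x - Far y‖ ≤ (P0 + P1 + 2 * P0) * SF * n123 * h ^ β := by
      rcases le_or_gt h 1 with hle | hgt
      · have hhβ : h ≤ h ^ β := by
          rcases hh0.eq_or_lt with h0 | hpos
          · rw [← h0, Real.zero_rpow hβ0.ne']
          · exact Real.self_le_rpow_of_le_one hh0 hle hβ1.le
        calc ‖Far x - Far y‖ ≤ (P1 * Bp + (L * P0 + Cm * P1) * Bq) * n123 * h := hFar1 x y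
          _ ≤ (P0 + P1) * SF * n123 * h := by gcongr
          _ ≤ (P0 + P1) * SF * n123 * h ^ β := mul_le_mul_of_nonneg_left hhβ (by positivity)
          _ ≤ (P0 + P1 + 2 * P0) * SF * n123 * h ^ β := by
              have : P0 + P1 ≤ P0 + P1 + 2 * P0 := by linarith
              have hhb : 0 ≤ h ^ β := Real.rpow_nonneg hh0 β
              gcongr
      · have h1h : 1 ≤ h ^ β := Real.one_le_rpow hgt.le hβ0.le
        calc ‖Far x - Far y‖ ≤ ‖Far x‖ + ‖Far y‖ := norm_sub_le _ _
          _ ≤ P0 * (Bp + Cm * Bq) * n123 + P0 * (Bp + Cm * Bq) * n123 := add_le_add (hFar0 x) (hFar0 y)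
          _ ≤ P0 * SF * n123 + P0 * SF * n123 := by gcongr
          _ = (2 * P0) * SF * n123 * 1 := by ring
          _ ≤ (P0 + P1 + 2 * P0) * SF * n123 * h ^ β := by
              have : 2 * P0 ≤ P0 + P1 + 2 * P0 := by linarith
              gcongr
    have hnear := hNH x y
    rw [hQ x, hQ y]
    calc ‖Far x - (∫ σ in Ioc 0 1, Φ σ x) - (Far y - ∫ σ in Ioc 0 1, Φ σ y)‖
        = ‖(Far x - Far y) - ((∫ σ in Ioc 0 1, Φ σ x) - ∫ σ in Ioc 0 1, Φ σ y)‖ := by abel_nf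
      _ ≤ ‖Far x - Far y‖ + ‖(∫ σ in Ioc 0 1, Φ σ x) - ∫ σ in Ioc 0 1, Φ σ y‖ := norm_sub_le _ _
      _ ≤ (P0 + P1 + 2 * P0) * SF * n123 * h ^ β +
            (4 * (K2 * (L * A + L' * M) * n123) / β + 2 * (K3 * (L * A + L' * M) * n123) / (1 - β)) * h ^ β :=
          add_le_add hfar hnear
      _ = ((P0 + P1 + 2 * P0) * SF + KN * (L * A + L' * M)) * n123 * h ^ β := by rw [hKN]; ring
      _ ≤ K * (SF + (L * A + L' * M)) * n123 * h ^ β := by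
          have hhb : 0 ≤ h ^ β := Real.rpow_nonneg hh0 β
          have hcoef : (P0 + P1 + 2 * P0) * SF + KN * (L * A + L' * M) ≤ K * (SF + (L * A + L' * M)) := by
            have h1 : (P0 + P1 + 2 * P0) * SF ≤ K * SF := mul_le_mul_of_nonneg_right hKfar hSF0
            have h2 : KN * (L * A + L' * M) ≤ K * (L * A + L' * M) := mul_le_mul_of_nonneg_right hKKN hS0
            linarith
          exact mul_le_mul_of_nonneg_right (mul_le_mul_of_nonneg_right hcoef hn0) hhb
      _ = K * (Bp + (Cm + L) * Bq + (L * A + L' * M)) * ‖v₁‖ * ‖v₂‖ * ‖v₃‖ * ‖x - y‖ ^ β := by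
          rw [hSF, hn123, hh_def]; ring

end Commutator

end TorusHeat

end Literature.Analysis.FluidPDE
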